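import Mathlib
import Summits.Ventures.HodgeRepro.Tier4.Line4.LevelVolume

/-!
# Tier4/Line4/SuppMeasure — C-L4-SUPPMEAS in the honest RATIO form: the level-measure of the support sets of the level
family, the main term in units of `suppMeasure N γ₀`, and the ratio display

Blind re-derivation cell `pub-hodge-repro`, Tier 4 «prove the step» (README §9–§10), seat t4-L2-p1 (gen 3; lead (R-30)
S15136 C-L4-SUPPMEAS, re-shaped by the finding S15147).  Tree path `lean/Summits/Ventures/HodgeRepro/Tier4/Line4/SuppMeasure.lean`.
Imports `Line4/LevelVolume` (p702383: `levelTf`, `levelNorm`, `ffinLevel`, `re_setIntegral_chi_innerFin_ge` through HorbMain).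
Mathlib-level; no literature.

THE FINDING (S15147).  The cut's shape `(μT ⊗ μT')(A_N γ) ≤ c · levelNorm N` is EXPECTED FALSE already at `γ = γ₀`: the
support set of the level-`N` test function on the torus pair is invariant under the DIAGONAL centre `Z_f` (`z` cancels in
`t⁻¹ γ₀ t′`), so it contains `≍ [Z_f ∩ K(1) : Z_f ∩ K(N)] ≍ N^{d}` translates of `(T_f ∩ K(N)) × (T′_f ∩ K(N))`; its measure
is `≍ N^{d} · levelNorm N ≍ N^{−3d}` — `3 = dim T + dim T′ − dim Z`, the dimension of the orbit, not `4 = 2 + 2`.  The honest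
uniform statement is the RATIO `suppMeasure N γ ≤ c · suppMeasure N γ₀` (expected TRUE along `q^n` with `c ≍ [K γ₀ K : K]`),
whose price is (a) the bounded double-coset index and (b) a quantitative transversality of `T_f/Z_f → T′_f\G_f` uniform in
`γ` — displayed here, not proved.

THE OBJECTS AND STATEMENTS.  `suppSet W γ₀ N γ := {(b, b′) ∈ T_f × T′_f : b⁻¹ γ_f b′ ∈ K(N) γ₀,f K(N)}` and
`suppMeasure W νf νf' γ₀ DZf N γ := (νf ⊗ νf′)(suppSet ∩ (DZ_f × T′_f))` — the UNFOLDED support measure of the chain (the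
set `re_setIntegral_chi_innerFin_ge` integrates over); `suppSetFolded` / `suppMeasureFolded` — the FOLDED twin `A_N γ` on
`D_T × D_T′` of the lead's (R-30) (the Setting's per-orbit integrals live there).  (1) `levelTf_prod_subset_suppSet`: `(T_f ∩ K(N)) × (T′_f ∩ K(N)) ⊆
suppSet γ₀`, so `levelNorm N ≤ suppMeasure N γ₀` once `levelTf N ⊆ DZ_f` (`levelNorm_le_suppMeasure`) — the LOSSY lower bound
of record (HorbLevel's `hmain ≥ m` is this bound inside the chain).  (2) **`re_setIntegral_chi_innerFin_ffinLevel_ge_suppMeasure`**: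
the finite main term of the natural witness is `≥ δ · levelNorm⁻¹ · suppMeasure N γ₀` — the SHARP form, in the unit the
level-measure assembly needs.  (3) `SuppMeasureComparisonAlong` — the ratio display along `q^n`, quantified OFF THE TRANSPORTER `γ⁻¹ T γ ≠ T′`
(lead (R-31)/(R-32)).

Nothing here says anything about the status of the Hodge conjecture for CM abelian varieties, which is NOT proved
(HC_CM is NOT proved by anyone in this repository).
-/

set_option autoImplicit false
noncomputable section
namespace Summit.Ventures.HodgeRepro.Tier4.Line4
open Summit.Ventures.HodgeRepro.Tier4 Summit.Ventures.HodgeRepro.Tier4.Common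
  Summit.Ventures.HodgeRepro.Tier4.Line1 MeasureTheory
open scoped ComplexConjugate Topology Pointwise NNReal ENNReal

section SuppSet
variable {k : Type} [Field k] [NumberField k] (W : PlaneData k)

/-- **The support set of the level-`N` witness on the torus pair**, at the rational point `γ`:
`{(b, b′) ∈ T_f × T′_f : b⁻¹ γ_f b′ ∈ K(N) γ₀,f K(N)}` (the pairs where `ffinLevel N (b⁻¹ γ_f b′) ≠ 0`). -/
def suppSet (γ₀ : GA W) (N : ℕ) (γ : GA W) : Set (torusFin W × torusFin' W) :=
  {p | (((p.1 : torusT W) : GA W))⁻¹ * GA.ofFinPart W γ * ((p.2 : torusT' W) : GA W) ∈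
    levelDoubleCoset W N (GA.ofFinPart W γ₀)}

/-- `(T_f ∩ K(N)) × (T′_f ∩ K(N)) ⊆ suppSet γ₀` (the main term's region). -/
theorem levelTf_prod_subset_suppSet (γ₀ : GA W) (N : ℕ) :
    levelTf W N ×ˢ levelTf' W N ⊆ suppSet W γ₀ N γ₀ := by
  rintro ⟨b, b'⟩ ⟨hb, hb'⟩
  exact orbit_mem_levelDoubleCoset_of_mem W γ₀ N hb hb'

/-- The support set is measurable (`N ≠ 0`: the double coset is compact, the orbit map continuous). -/
theorem measurableSet_suppSet [MeasurableSpace (GA W)] [BorelSpace (GA W)] (γ₀ : GA W) {N : ℕ} (hN : N ≠ 0)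
    (γ : GA W) : MeasurableSet (suppSet W γ₀ N γ) := by
  haveI : T2Space (GA W) := t2Space_GA W
  haveI : BorelSpace (torusT W) := Subtype.borelSpace _
  haveI : BorelSpace (torusT' W) := Subtype.borelSpace _
  haveI : BorelSpace (torusFin W) := Subtype.borelSpace _
  haveI : BorelSpace (torusFin' W) := Subtype.borelSpace _
  haveI : SecondCountableTopology (torusFin W) := secondCountable_torusFin W
  haveI : SecondCountableTopology (torusFin' W) := secondCountable_torusFin' W
  haveI : BorelSpace (torusFin W × torusFin' W) := Prod.borelSpace
  have hcont : Continuous fun p : torusFin W × torusFin' W =>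
      (((p.1 : torusT W) : GA W))⁻¹ * GA.ofFinPart W γ * ((p.2 : torusT' W) : GA W) :=
    ((continuous_subtype_val.comp (continuous_subtype_val.comp continuous_fst)).inv.mul continuous_const).mul
      (continuous_subtype_val.comp (continuous_subtype_val.comp continuous_snd))
  exact ((isCompact_levelDoubleCoset W hN _).isClosed.preimage hcont).measurableSet

end SuppSet

section Measure
variable {k : Type} [Field k] [NumberField k] (W : PlaneData k) [MeasurableSpace (GA W)] [BorelSpace (GA W)]
  (νf : Measure (torusFin W)) (νf' : Measure (torusFin' W)) (γ₀ : GA W) (DZf : Set (torusFin W))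

/-- **The unfolded support measure** `suppMeasure N γ := (ν_f ⊗ ν′_f)(suppSet γ ∩ (DZ_f × T′_f))`. -/
def suppMeasure (N : ℕ) (γ : GA W) : ℝ≥0∞ :=
  (νf.prod νf') (suppSet W γ₀ N γ ∩ DZf ×ˢ Set.univ)

omit [BorelSpace (GA W)] in
/-- **The lossy lower bound of record**: `levelNorm N ≤ suppMeasure N γ₀` once `levelTf N ⊆ DZ_f` (the support measure
finite — it is, under PROPER and ZDOMAIN-EX (iv), by `mem_compact_of_hasProperFinOrbit`). -/
theorem levelNorm_le_suppMeasure [νf.IsHaarMeasure] [νf'.IsHaarMeasure] (N : ℕ)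
    (hDZ : levelTf W N ⊆ DZf) (hfin : suppMeasure W νf νf' γ₀ DZf N γ₀ ≠ ⊤) :
    levelNorm W νf νf' N ≤ (suppMeasure W νf νf' γ₀ DZf N γ₀).toReal := by
  haveI : LocallyCompactSpace (torusFin W) := locallyCompact_torusFin W
  haveI : LocallyCompactSpace (torusFin' W) := locallyCompact_torusFin' W
  haveI : SecondCountableTopology (torusFin W) := secondCountable_torusFin W
  haveI : SecondCountableTopology (torusFin' W) := secondCountable_torusFin' W
  haveI : IsLocallyFiniteMeasure νf := isLocallyFiniteMeasure_of_isFiniteMeasureOnCompacts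
  haveI : IsLocallyFiniteMeasure νf' := isLocallyFiniteMeasure_of_isFiniteMeasureOnCompacts
  haveI : SigmaFinite νf := sigmaFinite_of_locallyFinite
  haveI : SigmaFinite νf' := sigmaFinite_of_locallyFinite
  have hsub : levelTf W N ×ˢ levelTf' W N ⊆ suppSet W γ₀ N γ₀ ∩ DZf ×ˢ Set.univ :=
    Set.subset_inter (levelTf_prod_subset_suppSet W γ₀ N) (Set.prod_mono hDZ (Set.subset_univ _))
  have hle : (νf.prod νf') (levelTf W N ×ˢ levelTf' W N) ≤ suppMeasure W νf νf' γ₀ DZf N γ₀ := measure_mono hsub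
  have heq : ((νf.prod νf') (levelTf W N ×ˢ levelTf' W N)).toReal = levelNorm W νf νf' N := by
    rw [Measure.prod_prod, ENNReal.toReal_mul]
    rfl
  rw [← heq]
  exact ENNReal.toReal_mono hfin hle

variable (R : RTFData W)

/-- **The finite main term of the natural witness in units of `suppMeasure N γ₀`** (the SHARP form): under the margin
`hδ` and the integrability `hint`, `δ · levelNorm⁻¹ · suppMeasure N γ₀ ≤ Re ∫_{DZ_f} χ(b) I_f(b) dν_f` for `F_f := ffinLevel N`
(`re_setIntegral_chi_innerFin_ge` with the integrand computed: `levelNorm⁻¹` on `suppSet γ₀`, `0` elsewhere). -/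
theorem re_setIntegral_chi_innerFin_ffinLevel_ge_suppMeasure [νf.IsHaarMeasure] [νf'.IsHaarMeasure]
    (hc : Continuous R.chi) (hu : ∀ a, ‖R.chi a‖ = 1) (hc' : Continuous R.chi') (hu' : ∀ a, ‖R.chi' a‖ = 1)
    {N : ℕ} (hN : N ≠ 0) (hDZf : MeasurableSet DZf) (δ : ℝ)
    (hδ : ∀ b ∈ DZf, ∀ b' : torusFin' W,
      ffinLevel W νf νf' γ₀ N ((((b : torusT W) : GA W))⁻¹ * GA.ofFinPart W γ₀ * ((b' : torusT' W) : GA W)) ≠ 0 →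
      δ ≤ (R.chi b * conj (R.chi' b')).re)
    (hint : IntegrableOn (fun p : torusFin W × torusFin' W => R.chi p.1 * conj (R.chi' p.2) *
      ffinLevel W νf νf' γ₀ N ((((p.1 : torusT W) : GA W))⁻¹ * GA.ofFinPart W γ₀ * ((p.2 : torusT' W) : GA W)))
      (DZf ×ˢ Set.univ) (νf.prod νf')) :
    δ * ((levelNorm W νf νf' N)⁻¹ * (suppMeasure W νf νf' γ₀ DZf N γ₀).toReal) ≤
      (∫ b in DZf, R.chi b * innerFin W R (ffinLevel W νf νf' γ₀ N) γ₀ νf' b ∂νf).re := by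
  haveI : BorelSpace (torusT W) := Subtype.borelSpace _
  haveI : BorelSpace (torusT' W) := Subtype.borelSpace _
  haveI : BorelSpace (torusFin W) := Subtype.borelSpace _
  haveI : BorelSpace (torusFin' W) := Subtype.borelSpace _
  haveI : SecondCountableTopology (torusFin W) := secondCountable_torusFin W
  haveI : SecondCountableTopology (torusFin' W) := secondCountable_torusFin' W
  haveI : BorelSpace (torusFin W × torusFin' W) := Prod.borelSpace
  have hmain := re_setIntegral_chi_innerFin_ge W R hc hu hc' hu' νf νf' (ffinLevel W νf νf' γ₀ N)
    (ffinLevel_im W νf νf' γ₀ N) (ffinLevel_re_nonneg W νf νf' γ₀ N hN) γ₀ DZf hDZf δ hδ hint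
  refine le_trans (le_of_eq ?_) hmain
  congr 1
  -- the integrand is `levelNorm⁻¹ · 1_{suppSet γ₀}`
  have hfun : (fun p : torusFin W × torusFin' W =>
      (ffinLevel W νf νf' γ₀ N ((((p.1 : torusT W) : GA W))⁻¹ * GA.ofFinPart W γ₀ * ((p.2 : torusT' W) : GA W))).re) =
      (suppSet W γ₀ N γ₀).indicator (fun _ => (levelNorm W νf νf' N)⁻¹) := by
    funext p
    by_cases hp : p ∈ suppSet W γ₀ N γ₀
    · rw [Set.indicator_of_mem hp, ffinLevel_of_mem W νf νf' γ₀ N (orbit_mem_finitePart W γ₀ p.1 p.2) hp,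
        Complex.ofReal_re]
    · rw [Set.indicator_of_notMem hp]
      have h0 : ffinLevel W νf νf' γ₀ N
          ((((p.1 : torusT W) : GA W))⁻¹ * GA.ofFinPart W γ₀ * ((p.2 : torusT' W) : GA W)) = 0 := by
        by_contra h0
        exact hp (mem_levelDoubleCoset_of_ffinLevel_ne_zero W νf νf' γ₀ N (orbit_mem_finitePart W γ₀ p.1 p.2) h0)
      rw [h0, Complex.zero_re]
  rw [hfun, integral_indicator (measurableSet_suppSet W γ₀ hN γ₀), Measure.restrict_restrict
    (measurableSet_suppSet W γ₀ hN γ₀), setIntegral_const, smul_eq_mul, measureReal_def, mul_comm]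
  rfl

end Measure

section Folded
variable {k : Type} [Field k] [NumberField k] (W : PlaneData k) [MeasurableSpace (GA W)] (R : RTFData W)

/-- **The folded support set `A_N γ`** on `D_T × D_T′` (the Setting's form, lead (R-30)):
`{(t, t′) ∈ D_T × D_T′ : (t⁻¹ γ t′)_f ∈ K(N) γ₀,f K(N)}`. -/
def suppSetFolded (γ₀ : GA W) (N : ℕ) (γ : GA W) : Set (torusT W × torusT' W) :=
  {p | p.1 ∈ R.DT ∧ p.2 ∈ R.DT' ∧
    GA.ofFinPart W ((p.1 : GA W)⁻¹ * γ * (p.2 : GA W)) ∈ levelDoubleCoset W N (GA.ofFinPart W γ₀)}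

/-- **The folded support measure** `(μ_T ⊗ μ_{T′})(A_N γ)`. -/
def suppMeasureFolded (γ₀ : GA W) (N : ℕ) (γ : GA W) : ℝ≥0∞ :=
  (R.μT.prod R.μT') (suppSetFolded W R γ₀ N γ)

end Folded

section Display
variable {k : Type} [Field k] [NumberField k] (W : PlaneData k) [MeasurableSpace (GA W)]
  (νf : Measure (torusFin W)) (νf' : Measure (torusFin' W)) (γ₀ : GA W) (DZf : Set (torusFin W))

/-- **THE RATIO DISPLAY (C-L4-SUPPMEAS in its honest form, S15147; lead (R-31)/(R-32): OFF THE TRANSPORTER)**: along the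
powers of one prime, for every rational `γ` with `γ⁻¹ T γ ≠ T′` the unfolded support measure at `γ` is at most a constant
times the one at `γ₀`.  Expected TRUE with `c ≍ [K γ₀ K : K]` (bounded along `q^n` for `q ∤ disc · den(γ₀)`); its price is
(a) that bounded double-coset index (elementary arithmetic, untyped) and (b) a quantitative transversality of
`T_f / Z_f → T′_f\G_f` uniform in `γ` (p-adic, untyped: the `t′`-fibre of the support set is a union of `≤ [K γ₀ K : K]`
cosets of `T′_f ∩ K(N)`, the `t`-projection a `1`-dimensional ball of radius `N^{−1}` times the compact `Z_f`-direction).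
ON the transporter (`γ⁻¹ T γ = T′`, at most two rational double cosets) the set carries the full `μ_T(D_T)` and the ratio
is unbounded — those double cosets are C-L4-TRANSPORTER's (an extra main term or zero by character orthogonality).
NOT proved here. -/
def SuppMeasureComparisonAlong (q : ℕ) : Prop :=
  ∃ c : ℝ, ∀ (n : ℕ) (γ : rationalPoints W),
    (torusT W).map (MulAut.conj ((γ : GA W))⁻¹).toMonoidHom ≠ torusT' W →
    (suppMeasure W νf νf' γ₀ DZf (q ^ n) (γ : GA W)).toReal ≤ c * (suppMeasure W νf νf' γ₀ DZf (q ^ n) γ₀).toReal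

end Display

end Summit.Ventures.HodgeRepro.Tier4.Line4

end
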